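import Summits.MatrixMultiplication.MatrixMultiplication.Theorems.ObstructionDescentUniversalOccurrenceTwoRectangleHookTableaux

set_option linter.dupNamespace false
set_option autoImplicit false

/-!
# Universal occurrence — two rectangles and the ODD HOOK `(2N-3,1,1,1)`, part A: the tableau (decomp-mm · lens 3 · gen 44)

Route `route-MatrixMultiplication-ObstructionDescent` (sub-problem `MatrixMultiplication`, `ω(ℂ) = 2`); SUPPORT for the crux
`NoOccurrenceObstruction` (`P_O`, item `stmt-MatrixMultiplication-29040`) through the universal-occurrence programme (NODE-g29…g44
of the decomp-mm cell, lens 3).  Nothing here proves `ω = 2` or closes an item; no `def`, no `sorry`, standard axioms.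

**Why.**  The floor law (part IX) reaches only third legs `ν ⊢ 2N` with all parts EVEN; the four-odd class (census v54, I238)
needs the storey law (part X) and a design whose third-leg words are fed to the polytabloid `e_T` of the hook `(2N-3,1,1,1)` —
ONE column of height `4` and an arm.  Unlike the doubled hooks of parts A–E (two equal columns, "twin" words of value `+1`),
a single column has no twin to cancel its sign: the value of `e_T` on a support word is the sign of the column reading, and the
design of part C (`…TwoRectangleOddHook`) must be shown to produce each column reading together with a COMPENSATING block sign.
This file isolates the tableau side.

**Contents.**  §1: the odd-hook tableau `T` (positions `0,1,2,3` down the column, positions `≥ 4` along the arm; `oddHookCell_*`,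
`mem_youngDiagram_oddHook`).  §2: support of `e_T` — a word `u` with `e_T(u) ≠ 0` vanishes on the arm and reads a permutation of
`{0,1,2,3}` down the column (`oddHookTableau_support`); value — `e_T(u) = sgn π` for the column reading `π ∈ S_4`
(`oddHookTableau_apply_eq_sign`, via `π.extendDomain` as an element of the column stabiliser), and `sgn π` as the parity of the
six inversions of the column letters (`sign_perm_fin_four_eq`, a `decide`; packaged as `oddHookTableau_apply_eq_parity`).

[cite: BurgisserIkenmeyer2011, Thm. 4.4, Lemma 6.1] [cite: BurgisserIkenmeyer2017, §5, Thm. 5.9 (proof of (2)), eq. (3.4)]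
-/

noncomputable section

open scoped BigOperators

namespace Summit.MatrixMultiplication.MatrixMultiplication.Theorems.ObstructionCalculus

open Literature.Computability.AlgebraicComplexity
open Literature.NumberTheory.DiophantineGeometry

/-! ### §1 The odd-hook tableau: the column `(0,0),(1,0),(2,0),(3,0)` on positions `0..3`, then the arm -/

/-- Cells of the odd-hook tableau are distinct. [folklore] -/
theorem oddHookCell_injective {p q : ℕ}
    (hpq : (if p < 4 then (p, 0) else (0, p - 3) : ℕ × ℕ) = (if q < 4 then (q, 0) else (0, q - 3))) : p = q := by
  split_ifs at hpq <;> simp only [Prod.mk.injEq] at hpq <;> omega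

/-- The odd-hook tableau is a standard filling for the position order. [folklore] -/
theorem oddHookCell_standard {p q : ℕ} (hpq : p < q) :
    ¬ ((if q < 4 then (q, 0) else (0, q - 3) : ℕ × ℕ) ≤ (if p < 4 then (p, 0) else (0, p - 3))) := by
  split_ifs <;> simp only [Prod.mk_le_mk] <;> omega

/-- The Young diagram of the odd hook `(2N-3,1,1,1)`: its boxes. [folklore] -/
theorem mem_youngDiagram_oddHook {N : ℕ} (ν : Nat.Partition (N * 2)) (hν : ν.sortedParts = [2 * N - 3, 1, 1, 1])
    {r c : ℕ} (h : (r = 0 ∧ c < 2 * N - 3) ∨ (1 ≤ r ∧ r < 4 ∧ c = 0)) : (r, c) ∈ ν.youngDiagram := by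
  rw [Nat.Partition.mem_youngDiagram_iff, hν]
  rcases h with ⟨rfl, hc⟩ | ⟨hr1, hr4, rfl⟩
  · exact ⟨by simp, by simpa using hc⟩
  · have hr : r = 1 ∨ r = 2 ∨ r = 3 := by omega
    rcases hr with rfl | rfl | rfl <;> exact ⟨by simp, by simp⟩

/-- The odd hook has four rows. [folklore] -/
theorem fst_lt_of_mem_youngDiagram_oddHook {N : ℕ} (ν : Nat.Partition (N * 2))
    (hν : ν.sortedParts = [2 * N - 3, 1, 1, 1]) {x : ℕ × ℕ} (hx : x ∈ ν.youngDiagram.cells) : x.1 < 4 := by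
  obtain ⟨h, -⟩ := (Nat.Partition.mem_youngDiagram_iff ν x).1 ((YoungDiagram.mem_cells _).1 hx)
  rw [hν] at h
  simpa using h

/-- The cells of the odd-hook tableau lie in `(2N-3,1,1,1)` (`2 ≤ N`). [folklore] -/
theorem oddHookCell_mem {N : ℕ} (hN : 2 ≤ N) (ν : Nat.Partition (N * 2)) (hν : ν.sortedParts = [2 * N - 3, 1, 1, 1])
    (p : ℕ) (hp : p < N * 2) : (if p < 4 then (p, 0) else (0, p - 3) : ℕ × ℕ) ∈ ν.youngDiagram := by
  split_ifs with h1 <;> apply mem_youngDiagram_oddHook ν hν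
  · rcases Nat.eq_zero_or_pos p with rfl | hp0
    · left; constructor <;> omega
    · right; refine ⟨?_, ?_, rfl⟩ <;> omega
  · left; constructor <;> omega

/-! ### §2 Support and value of the polytabloid `e_T` -/

/-- **Support of `e_T`.**  If `e_T(u) ≠ 0` then `u` vanishes on the arm and reads four distinct letters `< 4` down the column.
[folklore] -/
theorem oddHookTableau_support {N : ℕ} {Y : YoungDiagram} (hN : ∀ x ∈ Y.cells, x.1 < N) (T : StdFilling (N * 2) Y)
    (hT : ∀ p : Fin (N * 2), T.1 p = (if (p : ℕ) < 4 then ((p : ℕ), 0) else (0, (p : ℕ) - 3)))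
    {u : Word N (N * 2)} (hu : T.polytabloid ℂ hN u ≠ 0) :
    (∀ p : Fin (N * 2), 4 ≤ (p : ℕ) → ((u p : Fin N) : ℕ) = 0) ∧
    (∀ p : Fin (N * 2), (p : ℕ) < 4 → ((u p : Fin N) : ℕ) < 4) ∧
    (∀ p q : Fin (N * 2), (p : ℕ) < 4 → (q : ℕ) < 4 → u p = u q → p = q) := by
  classical
  obtain ⟨σ, hσ, rfl⟩ := StdFilling.exists_of_polytabloid_apply_ne_zero hN T hu
  have hcol : ∀ p, (T.1 (σ p)).2 = (T.1 p).2 := StdFilling.mem_colStab.1 hσ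
  have hval : ∀ p, ((StdFilling.rowWord hN T ∘ ⇑σ) p : ℕ) = (T.1 (σ p)).1 := fun p => rfl
  have hrow' : ∀ q : Fin (N * 2), (T.1 q).1 = if (q : ℕ) < 4 then (q : ℕ) else 0 := fun q => by
    rw [hT]; split_ifs <;> rfl
  have hcol' : ∀ q : Fin (N * 2), (T.1 q).2 = if (q : ℕ) < 4 then 0 else (q : ℕ) - 3 := fun q => by
    rw [hT]; split_ifs <;> rfl
  refine ⟨fun p hp => ?_, fun p hp => ?_, fun p q hp hq hpq => ?_⟩
  · have hc := hcol p
    rw [hcol', hcol'] at hc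
    rw [hval, hrow']
    split_ifs at hc ⊢ <;> omega
  · have hc := hcol p
    rw [hcol', hcol'] at hc
    rw [hval, hrow']
    split_ifs at hc ⊢ <;> omega
  · have hr : (T.1 (σ p)).1 = (T.1 (σ q)).1 := by
      rw [← hval, ← hval]; exact congrArg Fin.val hpq
    have hc : (T.1 (σ p)).2 = (T.1 (σ q)).2 := by
      rw [hcol, hcol, hcol', hcol', if_pos hp, if_pos hq]
    exact σ.injective (T.injective (Prod.ext hr hc))

/-- **Value of `e_T` on a column word.**  If `u` vanishes on the arm and `π ∈ S_4` reads the column (`π(i) = u(i)`, `i < 4`),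
then `e_T(u) = sgn π`: `u = w_T ∘ ρ` for the column permutation `ρ = π` extended by the identity, and `e_T(w_T ∘ ρ) = sgn ρ`.
[folklore] -/
theorem oddHookTableau_apply_eq_sign {N : ℕ} {Y : YoungDiagram} (hN : ∀ x ∈ Y.cells, x.1 < N) (T : StdFilling (N * 2) Y)
    (hT : ∀ p : Fin (N * 2), T.1 p = (if (p : ℕ) < 4 then ((p : ℕ), 0) else (0, (p : ℕ) - 3)))
    (h4 : 4 ≤ N * 2) {u : Word N (N * 2)} (harm : ∀ p : Fin (N * 2), 4 ≤ (p : ℕ) → ((u p : Fin N) : ℕ) = 0)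
    (π : Equiv.Perm (Fin 4)) (hπ : ∀ i : Fin 4, ((π i : Fin 4) : ℕ) = ((u ⟨i, by omega⟩ : Fin N) : ℕ)) :
    T.polytabloid ℂ hN u = ((Equiv.Perm.sign π : ℤ) : ℂ) := by
  classical
  let f : Fin 4 ≃ {p : Fin (N * 2) // (p : ℕ) < 4} :=
    { toFun := fun i => ⟨⟨i, by omega⟩, i.2⟩
      invFun := fun p => ⟨p.1, p.2⟩
      left_inv := fun i => Fin.ext rfl
      right_inv := fun p => Subtype.ext (Fin.ext rfl) }
  obtain ⟨ρ, hρ⟩ : ∃ ρ : Equiv.Perm (Fin (N * 2)), ρ = π.extendDomain f := ⟨_, rfl⟩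
  have hρ_lt : ∀ (p : Fin (N * 2)) (hp : (p : ℕ) < 4), ((ρ p : Fin (N * 2)) : ℕ) = ((π ⟨p, hp⟩ : Fin 4) : ℕ) := by
    intro p hp
    rw [hρ, Equiv.Perm.extendDomain_apply_subtype π f hp]
    rfl
  have hρ_ge : ∀ p : Fin (N * 2), ¬ (p : ℕ) < 4 → ρ p = p := fun p hp => by
    rw [hρ]; exact Equiv.Perm.extendDomain_apply_not_subtype π f hp
  have hcol' : ∀ q : Fin (N * 2), (T.1 q).2 = if (q : ℕ) < 4 then 0 else (q : ℕ) - 3 := fun q => by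
    rw [hT]; split_ifs <;> rfl
  have hrow' : ∀ q : Fin (N * 2), (T.1 q).1 = if (q : ℕ) < 4 then (q : ℕ) else 0 := fun q => by
    rw [hT]; split_ifs <;> rfl
  have hρcol : ρ ∈ T.colStab := StdFilling.mem_colStab.2 fun p => by
    rw [hcol', hcol']
    by_cases hp : (p : ℕ) < 4
    · have h1 := hρ_lt p hp
      have h2 : ((ρ p : Fin (N * 2)) : ℕ) < 4 := by rw [h1]; exact (π ⟨p, hp⟩).2
      rw [if_pos h2, if_pos hp]
    · rw [hρ_ge p hp]
  have hu : u = T.rowWord hN ∘ ⇑ρ := by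
    funext p
    apply Fin.ext
    show ((u p : Fin N) : ℕ) = (T.1 (ρ p)).1
    rw [hrow']
    by_cases hp : (p : ℕ) < 4
    · have h1 := hρ_lt p hp
      have h2 : ((ρ p : Fin (N * 2)) : ℕ) < 4 := by rw [h1]; exact (π ⟨p, hp⟩).2
      rw [if_pos h2, h1, hπ ⟨p, hp⟩]
    · rw [hρ_ge p hp, if_neg hp]
      exact harm p (by omega)
  have h := congrFun (StdFilling.wordPerm_polytabloid_of_mem_colStab (k := ℂ) hN T hρcol) (T.rowWord hN)
  rw [wordPerm_apply, Pi.smul_apply, smul_eq_mul, StdFilling.polytabloid_apply_rowWord, mul_one] at h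
  rw [hu, h, hρ, Equiv.Perm.sign_extendDomain]

set_option maxHeartbeats 400000 in
/-- The sign of a permutation of `{0,1,2,3}` is the parity of its six inversions (checked by `decide`). [folklore] -/
theorem sign_perm_fin_four_eq (π : Equiv.Perm (Fin 4)) : ((Equiv.Perm.sign π : ℤ) : ℂ) =
    if ((if ((π 1 : Fin 4) : ℕ) < ((π 0 : Fin 4) : ℕ) then 1 else 0) + (if ((π 2 : Fin 4) : ℕ) < ((π 0 : Fin 4) : ℕ) then 1 else 0) +
        (if ((π 3 : Fin 4) : ℕ) < ((π 0 : Fin 4) : ℕ) then 1 else 0) + (if ((π 2 : Fin 4) : ℕ) < ((π 1 : Fin 4) : ℕ) then 1 else 0) +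
        (if ((π 3 : Fin 4) : ℕ) < ((π 1 : Fin 4) : ℕ) then 1 else 0) +
        (if ((π 3 : Fin 4) : ℕ) < ((π 2 : Fin 4) : ℕ) then 1 else 0)) % 2 = 0
    then 1 else -1 := by
  have key : ∀ τ : Equiv.Perm (Fin 4), ((Equiv.Perm.sign τ : ℤˣ) : ℤ) =
      if ((if ((τ 1 : Fin 4) : ℕ) < ((τ 0 : Fin 4) : ℕ) then 1 else 0) + (if ((τ 2 : Fin 4) : ℕ) < ((τ 0 : Fin 4) : ℕ) then 1 else 0) +
          (if ((τ 3 : Fin 4) : ℕ) < ((τ 0 : Fin 4) : ℕ) then 1 else 0) + (if ((τ 2 : Fin 4) : ℕ) < ((τ 1 : Fin 4) : ℕ) then 1 else 0) +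
          (if ((τ 3 : Fin 4) : ℕ) < ((τ 1 : Fin 4) : ℕ) then 1 else 0) +
          (if ((τ 3 : Fin 4) : ℕ) < ((τ 2 : Fin 4) : ℕ) then 1 else 0)) % 2 = 0
      then 1 else -1 := by
    decide
  rw [key π]
  split_ifs <;> simp

/-- **Value of `e_T` on a support word, as a parity.**  If `u` vanishes on the arm and reads four distinct letters `< 4` down
the column, then `e_T(u) = (-1)^{#inversions of (u 0, u 1, u 2, u 3)}`. [folklore] -/
theorem oddHookTableau_apply_eq_parity {N : ℕ} {Y : YoungDiagram} (hN : ∀ x ∈ Y.cells, x.1 < N) (T : StdFilling (N * 2) Y)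
    (hT : ∀ p : Fin (N * 2), T.1 p = (if (p : ℕ) < 4 then ((p : ℕ), 0) else (0, (p : ℕ) - 3)))
    (h4 : 4 ≤ N * 2) {u : Word N (N * 2)} (harm : ∀ p : Fin (N * 2), 4 ≤ (p : ℕ) → ((u p : Fin N) : ℕ) = 0)
    (hlt : ∀ p : Fin (N * 2), (p : ℕ) < 4 → ((u p : Fin N) : ℕ) < 4)
    (hinj : ∀ p q : Fin (N * 2), (p : ℕ) < 4 → (q : ℕ) < 4 → u p = u q → p = q) :
    T.polytabloid ℂ hN u =
      if ((if ((u ⟨1, by omega⟩ : Fin N) : ℕ) < ((u ⟨0, by omega⟩ : Fin N) : ℕ) then 1 else 0) +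
          (if ((u ⟨2, by omega⟩ : Fin N) : ℕ) < ((u ⟨0, by omega⟩ : Fin N) : ℕ) then 1 else 0) +
          (if ((u ⟨3, by omega⟩ : Fin N) : ℕ) < ((u ⟨0, by omega⟩ : Fin N) : ℕ) then 1 else 0) +
          (if ((u ⟨2, by omega⟩ : Fin N) : ℕ) < ((u ⟨1, by omega⟩ : Fin N) : ℕ) then 1 else 0) +
          (if ((u ⟨3, by omega⟩ : Fin N) : ℕ) < ((u ⟨1, by omega⟩ : Fin N) : ℕ) then 1 else 0) +
          (if ((u ⟨3, by omega⟩ : Fin N) : ℕ) < ((u ⟨2, by omega⟩ : Fin N) : ℕ) then 1 else 0)) % 2 = 0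
      then 1 else -1 := by
  classical
  -- the column reading as a permutation of `Fin 4`
  let g : Fin 4 → Fin 4 := fun i => ⟨((u ⟨i, by omega⟩ : Fin N) : ℕ), hlt _ (by simp)⟩
  have hg : Function.Injective g := by
    intro i j hij
    have h1 : ((u ⟨i, by omega⟩ : Fin N) : ℕ) = ((u ⟨j, by omega⟩ : Fin N) : ℕ) := by
      have h := Fin.ext_iff.1 hij
      exact h
    have h2 := hinj ⟨i, by omega⟩ ⟨j, by omega⟩ (by simp) (by simp) (Fin.ext h1)
    exact Fin.ext (by simpa using congrArg Fin.val h2)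
  let π : Equiv.Perm (Fin 4) := Equiv.ofBijective g (Finite.injective_iff_bijective.1 hg)
  have hπ : ∀ i : Fin 4, ((π i : Fin 4) : ℕ) = ((u ⟨i, by omega⟩ : Fin N) : ℕ) := fun i => rfl
  have e0 : ((π 0 : Fin 4) : ℕ) = ((u ⟨0, by omega⟩ : Fin N) : ℕ) := rfl
  have e1 : ((π 1 : Fin 4) : ℕ) = ((u ⟨1, by omega⟩ : Fin N) : ℕ) := rfl
  have e2 : ((π 2 : Fin 4) : ℕ) = ((u ⟨2, by omega⟩ : Fin N) : ℕ) := rfl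
  have e3 : ((π 3 : Fin 4) : ℕ) = ((u ⟨3, by omega⟩ : Fin N) : ℕ) := rfl
  rw [oddHookTableau_apply_eq_sign hN T hT h4 harm π hπ, sign_perm_fin_four_eq π, e0, e1, e2, e3]

end Summit.MatrixMultiplication.MatrixMultiplication.Theorems.ObstructionCalculus

end
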